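import Summits.ValiantsHypothesis.ValiantsHypothesis.Theorems.BarrierLeverPartitionMinorsCoordinateLift

/-!
# Route BarrierLever — Chow witnesses for partition minors (items 20172 / 20195): the COORDINATE LIFT
# along ARBITRARY embeddings (adding `k` `x`-coordinates and `k'` `y`-coordinates at once)

Helper file (`--supports stmt-ValiantsHypothesis-20172`; cell valiant-natproofs, rung V4, 𝒟-side of
door (c); seat val-np-p4 gen 14).  Closes NO item; no definitions.  The tree's `…CoordinateLift`
lifts a height-`h` situation to height `h + 1` along `a.succAbove` / `c.succAbove` (ONE new row
coordinate, ONE new column coordinate); the `k`-fold steps whose determinant cores are now in the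
tree (`…ChowMultiTensorStepDet`, `…ChowStarGadgetStepDet`) need `k` new coordinates at once.  This
file redoes the lift along arbitrary embeddings `σx : Fin h ↪ Fin hx`, `σy : Fin h ↪ Fin hy` of the
`x`- and `y`-coordinates (the new coordinates are the complements of the ranges):

* `embLift_apply_castAdd/natAdd`, `embLift_injective`, `not_mem_range_embLift`;
* `mapDomain_embLift_partitionExpo`, `coeff_embLift_rename` — `coeff (E (U.map σx) (W.map σy)) (rename L P) = coeff (E U W) P`;
* `support_rename_embLift` — a lifted polynomial involves no variable off the ranges;
* `eq_map_preimage_of_subset_range` — a face inside the range of `σ` is the lift of its preimage;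
* `chow_hit_embLift` — **a hit layout stays hit after lifting along `(σx, σy)`** (renamed forms plus
  constant forms; needs `h ≤ hx`, `h ≤ hy` only through the form count `hx + hy ≥ h + h`).

Here `L = Fin.append (castAdd hy ∘ σx) (natAdd hx ∘ σy) : Fin (h+h) → Fin (hx+hy)` is written out in
every statement (no definition).

WHAT THIS IS NOT: bookkeeping; nothing on items 20195 / 20172 / 19717 themselves, on crux
stmt-ValiantsHypothesis-14610, or on `VP` versus `VNP`.
-/

set_option linter.dupNamespace false

namespace Summit.ValiantsHypothesis.ValiantsHypothesis.Theorems.BarrierLever.ChowFactor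

open Finset MvPolynomial

noncomputable section

variable {h hx hy : ℕ}

/-! ## 1. The lift of variables along embeddings -/

/-- An `x`-variable is not a `y`-variable (general block sizes). -/
theorem castAdd_ne_natAdd' (a : Fin hx) (c : Fin hy) : Fin.castAdd hy a ≠ Fin.natAdd hx c := by
  intro e
  have := congrArg Fin.val e
  simp only [Fin.val_castAdd, Fin.val_natAdd] at this
  omega

/-- The lift on an `x`-variable. -/
theorem embLift_apply_castAdd (σx : Fin h ↪ Fin hx) (σy : Fin h ↪ Fin hy) (b : Fin h) :
    Fin.append (fun b : Fin h => Fin.castAdd hy (σx b)) (fun d : Fin h => Fin.natAdd hx (σy d))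
        (Fin.castAdd h b) = Fin.castAdd hy (σx b) :=
  Fin.append_left _ _ b

/-- The lift on a `y`-variable. -/
theorem embLift_apply_natAdd (σx : Fin h ↪ Fin hx) (σy : Fin h ↪ Fin hy) (d : Fin h) :
    Fin.append (fun b : Fin h => Fin.castAdd hy (σx b)) (fun d : Fin h => Fin.natAdd hx (σy d))
        (Fin.natAdd h d) = Fin.natAdd hx (σy d) :=
  Fin.append_right _ _ d

/-- The lift of variables is injective. -/
theorem embLift_injective (σx : Fin h ↪ Fin hx) (σy : Fin h ↪ Fin hy) :
    Function.Injective (Fin.append (fun b : Fin h => Fin.castAdd hy (σx b))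
      (fun d : Fin h => Fin.natAdd hx (σy d))) := by
  intro v v' hv
  induction v using Fin.addCases with
  | left b =>
    induction v' using Fin.addCases with
    | left b' =>
      rw [embLift_apply_castAdd, embLift_apply_castAdd] at hv
      rw [σx.injective (Fin.castAdd_injective _ _ hv)]
    | right d' =>
      rw [embLift_apply_castAdd, embLift_apply_natAdd] at hv
      exact absurd hv (castAdd_ne_natAdd' _ _)
  | right d =>
    induction v' using Fin.addCases with
    | left b' =>
      rw [embLift_apply_natAdd, embLift_apply_castAdd] at hv
      exact absurd hv.symm (castAdd_ne_natAdd' _ _)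
    | right d' =>
      rw [embLift_apply_natAdd, embLift_apply_natAdd] at hv
      rw [σy.injective (Fin.natAdd_injective _ _ hv)]

/-- A variable `x_a` with `a` off the range of `σx`, or `y_c` with `c` off the range of `σy`, is not in
the range of the lift. -/
theorem not_mem_range_embLift (σx : Fin h ↪ Fin hx) (σy : Fin h ↪ Fin hy) (v : Fin (hx + hy))
    (hv : (∃ a, a ∉ Set.range σx ∧ v = Fin.castAdd hy a) ∨ ∃ c, c ∉ Set.range σy ∧ v = Fin.natAdd hx c) :
    v ∉ Set.range (Fin.append (fun b : Fin h => Fin.castAdd hy (σx b))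
      (fun d : Fin h => Fin.natAdd hx (σy d))) := by
  rintro ⟨v', hv'⟩
  induction v' using Fin.addCases with
  | left b =>
    rw [embLift_apply_castAdd] at hv'
    rcases hv with ⟨a, ha, rfl⟩ | ⟨c, hc, rfl⟩
    · exact ha ⟨b, Fin.castAdd_injective _ _ hv'⟩
    · exact castAdd_ne_natAdd' _ _ hv'
  | right d =>
    rw [embLift_apply_natAdd] at hv'
    rcases hv with ⟨a, ha, rfl⟩ | ⟨c, hc, rfl⟩
    · exact castAdd_ne_natAdd' _ _ hv'.symm
    · exact hc ⟨d, Fin.natAdd_injective _ _ hv'⟩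

/-! ## 2. Exponents, coefficients and supports under the lift -/

/-- **The lift carries `E U W` to `E (U.map σx) (W.map σy)`.** -/
theorem mapDomain_embLift_partitionExpo (σx : Fin h ↪ Fin hx) (σy : Fin h ↪ Fin hy)
    (U W : Finset (Fin h)) :
    Finsupp.mapDomain (Fin.append (fun b : Fin h => Fin.castAdd hy (σx b))
        (fun d : Fin h => Fin.natAdd hx (σy d)))
      (∑ b ∈ U, Finsupp.single (Fin.castAdd h b) 1 + ∑ d ∈ W, Finsupp.single (Fin.natAdd h d) 1 :
        Fin (h + h) →₀ ℕ) =
      ∑ a' ∈ U.map σx, Finsupp.single (Fin.castAdd hy a') 1 +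
        ∑ c' ∈ W.map σy, Finsupp.single (Fin.natAdd hx c') 1 := by
  rw [Finsupp.mapDomain_add, Finsupp.mapDomain_finsetSum, Finsupp.mapDomain_finsetSum,
    Finset.sum_map, Finset.sum_map]
  congr 1
  · refine Finset.sum_congr rfl fun b _ => ?_
    rw [Finsupp.mapDomain_single, embLift_apply_castAdd]
  · refine Finset.sum_congr rfl fun d _ => ?_
    rw [Finsupp.mapDomain_single, embLift_apply_natAdd]

/-- **Coefficients under the lift**: `coeff (E (U.map σx) (W.map σy)) (rename L P) = coeff (E U W) P`. -/
theorem coeff_embLift_rename {R : Type*} [CommSemiring R] (σx : Fin h ↪ Fin hx) (σy : Fin h ↪ Fin hy)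
    (U W : Finset (Fin h)) (P : MvPolynomial (Fin (h + h)) R) :
    coeff (∑ a' ∈ U.map σx, Finsupp.single (Fin.castAdd hy a') 1 +
        ∑ c' ∈ W.map σy, Finsupp.single (Fin.natAdd hx c') 1)
      (rename (Fin.append (fun b : Fin h => Fin.castAdd hy (σx b))
        (fun d : Fin h => Fin.natAdd hx (σy d))) P) =
      coeff (∑ b ∈ U, Finsupp.single (Fin.castAdd h b) 1 + ∑ d ∈ W, Finsupp.single (Fin.natAdd h d) 1)
        P := by
  rw [← mapDomain_embLift_partitionExpo, coeff_rename_mapDomain _ (embLift_injective σx σy)]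

/-- **A lifted polynomial involves no variable off the ranges of the embeddings.** -/
theorem support_rename_embLift {R : Type*} [CommSemiring R] (σx : Fin h ↪ Fin hx) (σy : Fin h ↪ Fin hy)
    (P : MvPolynomial (Fin (h + h)) R) :
    ∀ m ∈ (rename (Fin.append (fun b : Fin h => Fin.castAdd hy (σx b))
        (fun d : Fin h => Fin.natAdd hx (σy d))) P).support,
      ∀ v, ((∃ a, a ∉ Set.range σx ∧ v = Fin.castAdd hy a) ∨ ∃ c, c ∉ Set.range σy ∧ v = Fin.natAdd hx c) →
        m v = 0 := by
  classical
  intro m hm v hv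
  rw [support_rename_of_injective (embLift_injective σx σy)] at hm
  obtain ⟨m', -, rfl⟩ := Finset.mem_image.mp hm
  exact Finsupp.mapDomain_notin_range _ _ (not_mem_range_embLift σx σy v hv)

/-! ## 3. Faces -/

/-- **A face inside the range of `σ` is the lift of its preimage.** -/
theorem eq_map_preimage_of_subset_range {n n' : ℕ} (σ : Fin n ↪ Fin n') (S : Finset (Fin n'))
    (hS : ∀ x ∈ S, x ∈ Set.range σ) :
    S = (S.preimage σ σ.injective.injOn).map σ := by
  classical
  ext x
  rw [Finset.mem_map]
  constructor
  · intro hx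
    obtain ⟨z, rfl⟩ := hS x hx
    exact ⟨z, Finset.mem_preimage.mpr hx, rfl⟩
  · rintro ⟨z, hz, rfl⟩
    exact Finset.mem_preimage.mp hz

/-- The part of a face inside the range of `σ` (filter) is the lift of the preimage. -/
theorem filter_mem_range_eq_map_preimage {n n' : ℕ} (σ : Fin n ↪ Fin n') (S : Finset (Fin n'))
    [DecidablePred (· ∈ Set.range σ)] :
    S.filter (· ∈ Set.range σ) = (S.preimage σ σ.injective.injOn).map σ := by
  classical
  ext x
  rw [Finset.mem_filter, Finset.mem_map]
  constructor
  · rintro ⟨hx, ⟨z, rfl⟩⟩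
    exact ⟨z, Finset.mem_preimage.mpr hx, rfl⟩
  · rintro ⟨z, hz, rfl⟩
    exact ⟨Finset.mem_preimage.mp hz, ⟨z, rfl⟩⟩

/-! ## 4. Lifting a Chow witness -/

/-- **Lifting a Chow witness along embeddings.**  If the layout `(U, W)` of height `h` is hit by a
product of `h + h` affine forms, then `(U.map σx, W.map σy)` of heights `hx, hy` (with `h + h ≤ hx + hy`)
is hit by a product of `hx + hy` affine forms in the variables `Fin (hx + hy)` (the renamed forms,
followed by constant forms `1`). -/
theorem chow_hit_embLift (σx : Fin h ↪ Fin hx) (σy : Fin h ↪ Fin hy) (hle : h + h ≤ hx + hy)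
    {r : ℕ} (U W : Fin r → Finset (Fin h))
    (hhit : ∃ ℓ : Fin (h + h) → MvPolynomial (Fin (h + h)) ℂ, (∀ k, (ℓ k).totalDegree ≤ 1) ∧
      (Matrix.of fun i j : Fin r => coeff
        (∑ b ∈ U i, Finsupp.single (Fin.castAdd h b) 1 + ∑ d ∈ W j, Finsupp.single (Fin.natAdd h d) 1)
        (∏ k, ℓ k)).det ≠ 0) :
    ∃ ℓ : Fin (hx + hy) → MvPolynomial (Fin (hx + hy)) ℂ, (∀ k, (ℓ k).totalDegree ≤ 1) ∧
      (Matrix.of fun i j : Fin r => coeff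
        (∑ a' ∈ (U i).map σx, Finsupp.single (Fin.castAdd hy a') 1 +
          ∑ c' ∈ (W j).map σy, Finsupp.single (Fin.natAdd hx c') 1)
        (∏ k, ℓ k)).det ≠ 0 := by
  classical
  obtain ⟨ℓ, hdeg, hdet⟩ := hhit
  set L : Fin (h + h) → Fin (hx + hy) := Fin.append (fun b : Fin h => Fin.castAdd hy (σx b))
    (fun d : Fin h => Fin.natAdd hx (σy d)) with hL
  obtain ⟨e₀, he₀⟩ : ∃ e₀, hx + hy = (h + h) + e₀ := ⟨hx + hy - (h + h), by omega⟩
  set e : Fin ((h + h) + e₀) ≃ Fin (hx + hy) := finCongr he₀.symm with he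
  set ℓ' : Fin ((h + h) + e₀) → MvPolynomial (Fin (hx + hy)) ℂ :=
    Fin.append (fun k => rename L (ℓ k)) (fun _ => 1) with hℓ'
  refine ⟨fun k => ℓ' (e.symm k), fun k => ?_, ?_⟩
  · show (ℓ' (e.symm k)).totalDegree ≤ 1
    generalize e.symm k = k₀
    rw [hℓ']
    induction k₀ using Fin.addCases with
    | left k' =>
      rw [Fin.append_left]
      exact totalDegree_rename_le_one L (ℓ k') (hdeg k')
    | right k' =>
      rw [Fin.append_right, totalDegree_one]
      exact Nat.zero_le _
  · have hprod : (∏ k, ℓ' (e.symm k)) = rename L (∏ k, ℓ k) := by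
      rw [Fintype.prod_equiv e.symm (fun k => ℓ' (e.symm k)) ℓ' (fun _ => rfl), hℓ',
        Fin.prod_univ_add]
      simp only [Fin.append_left, Fin.append_right, Finset.prod_const_one, mul_one]
      rw [map_prod]
    rw [hprod]
    have hM : (Matrix.of fun i j : Fin r => coeff
        (∑ a' ∈ (U i).map σx, Finsupp.single (Fin.castAdd hy a') 1 +
          ∑ c' ∈ (W j).map σy, Finsupp.single (Fin.natAdd hx c') 1)
        (rename L (∏ k, ℓ k))) =
        Matrix.of fun i j : Fin r => coeff
          (∑ b ∈ U i, Finsupp.single (Fin.castAdd h b) 1 + ∑ d ∈ W j, Finsupp.single (Fin.natAdd h d) 1)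
          (∏ k, ℓ k) := by
      ext i j
      rw [Matrix.of_apply, Matrix.of_apply, hL, coeff_embLift_rename]
    rw [hM]
    exact hdet

end

end Summit.ValiantsHypothesis.ValiantsHypothesis.Theorems.BarrierLever.ChowFactor
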